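import Literature.Analysis.FunctionSpaces.HolderNormProofs
import Literature.Analysis.FunctionSpaces.TorusSpaceTime
import HarnessLib

/-!
# Hölder norms on the flat torus: intrinsic versus lifted, products, compositions

The accepted Hölder notions of the tree come in two flavours: the intrinsic inhomogeneous norm
`eBoundedHolderNorm r g = ‖g‖_∞ + [g]_r` of `g : T^d → Y` for the product (sup) metric of
`UnitAddTorus d = d → ℝ/ℤ` (`HolderNorm`; this is the norm in which forces are measured in
`Literature.Analysis.FluidPDE.brue_deLellis_anomalous_dissipation` and
`Literature.Barriers.AnomalousDissipation.Cheskidov2023_thm21_noDissipationAnomaly`), and the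
`C^{k,r}(T^d)` scale `Torus.eContDiffHolderNorm k r g = ∑_{j ≤ k} ‖Dʲ(lift g)‖_∞ + [Dᵏ(lift g)]_r`
of the periodic lift (`HolderNorm`, De Lellis–Székelyhidi 2013, §2; the norm of the mixing estimates
`Literature.Turb.Cheskidov2023_thm31_quasiSelfSimilarMixing` (i)). This file provides the elementary
bridge between them and the algebra needed to estimate Euler/Navier–Stokes forces in `C^{0,r}`:

* good lifts (`UnitAddCircle.exists_lift_abs_sub_eq_dist`,
  `Torus.exists_lift_norm_sub_le`): two points of `T^d` have representatives in `ℝ^d` at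
  Euclidean distance `≤ √d · dist`;
* the bridge `Torus.eBoundedHolderNorm_le_eContDiffHolderNorm_zero`:
  `‖g‖_∞ + [g]_r ≤ (1 + (√d)^r) ‖g‖_{C^{0,r}}`, and for first derivatives of `C¹` functions
  `Torus.eBoundedHolderNorm_partialDeriv_le`: `‖∂ᵢg‖_∞ + [∂ᵢg]_r ≤ (1 + (√d)^r) ‖g‖_{C^{1,r}}`
  (Gilbarg–Trudinger §4.1: equivalence of the `C^{k,α}` norms defined through all partial
  derivatives and through the full differential);
* the product rule `[a • b]_r ≤ ‖a‖_∞ [b]_r + [a]_r ‖b‖_∞` (`eHolderNorm_smul_le`,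
  `eBoundedHolderNorm_smul_le`; Gilbarg–Trudinger (4.7)), homogeneity
  (`eBoundedHolderNorm_const_smul`), and monotonicity under pre-composition with `1`-Lipschitz
  maps and post-composition with norm-non-increasing maps (`eBoundedHolderNorm_comp_le_of_lipschitz`,
  `eBoundedHolderNorm_postcomp_le`).

* `C^{0,r}` bounds from `C¹` bounds (`Torus.lipschitzWith_of_norm_partialDeriv_le`,
  `Torus.eBoundedHolderNorm_le_of_norm_le_of_norm_partialDeriv_le`) and the uniform-in-time
  bound `Torus.IsSmoothSpaceTimeOn.exists_forall_eBoundedHolderNorm_le` for jointly smooth fields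
  on compact time sets (used to choose viscosities adaptively in the vanishing-viscosity families
  of `Cheskidov2023_thm21_noDissipationAnomaly`).

All statements are inequalities in `ℝ≥0∞` (total, like the accepted norms); the product rule
carries finiteness hypotheses (`MemBoundedHolder`), under which Mathlib's `MemHolder.holderWith`
realises the seminorm as a Hölder constant.

## References

* D. Gilbarg, N. Trudinger, *Elliptic PDE of second order* (2001), §4.1, (4.4)–(4.7)
  (Hölder norms, products, equivalent norms).
* C. De Lellis, L. Székelyhidi Jr., *Dissipative continuous Euler flows*, Invent. Math. 193
  (2013), §2 (Hölder norms on `T³`).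
-/

open Set Topology Filter
open scoped NNReal ENNReal

noncomputable section

namespace Literature.Analysis.FunctionSpaces

/-! ## Good lifts -/

namespace Torus

variable {d : Type*} [Fintype d]



/-- Good lifts on the circle: two points of `ℝ/ℤ` have real representatives at distance exactly
their distance in `ℝ/ℤ` (lift the second point by the nearest-integer translate). [folklore] -/
theorem _root_.UnitAddCircle.exists_lift_abs_sub_eq_dist (u v : UnitAddCircle) :
    ∃ a b : ℝ, (a : UnitAddCircle) = u ∧ (b : UnitAddCircle) = v ∧ |a - b| = dist u v := by
  obtain ⟨a, rfl⟩ := QuotientAddGroup.mk_surjective u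
  obtain ⟨b₀, rfl⟩ := QuotientAddGroup.mk_surjective v
  refine ⟨a, b₀ + round (a - b₀), rfl, ?_, ?_⟩
  · rw [AddCircle.coe_add]
    have : ((round (a - b₀) : ℝ) : UnitAddCircle) = 0 := by
      rw [AddCircle.coe_eq_zero_iff]
      exact ⟨round (a - b₀), by simp⟩
    rw [this, add_zero]
  · change |a - (b₀ + round (a - b₀))| = dist (a : UnitAddCircle) (b₀ : UnitAddCircle)
    rw [dist_eq_norm, ← AddCircle.coe_sub, UnitAddCircle.norm_eq]
    ring_nf

/-- Good lifts on the torus: two points of `T^d` have representatives in `ℝ^d` whose coordinates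
differ by at most the (sup) distance on `T^d` (coordinatewise good lifts;
`dist_le_pi_dist`). [folklore] -/
theorem exists_lift_forall_abs_sub_le_dist (x y : UnitAddTorus d) :
    ∃ a b : EuclideanSpace ℝ d, proj a = x ∧ proj b = y ∧ ∀ i, |a i - b i| ≤ dist x y := by
  choose a b ha hb hab using fun i => UnitAddCircle.exists_lift_abs_sub_eq_dist (x i) (y i)
  refine ⟨WithLp.toLp 2 a, WithLp.toLp 2 b, ?_, ?_, fun i => ?_⟩
  · funext i; simp [proj_apply, ha]
  · funext i; simp [proj_apply, hb]
  · simp only [hab]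
    exact dist_le_pi_dist x y i

/-- The Euclidean distance of good lifts is at most `√d` times the distance on `T^d`. [folklore] -/
theorem exists_lift_norm_sub_le (x y : UnitAddTorus d) :
    ∃ a b : EuclideanSpace ℝ d, proj a = x ∧ proj b = y ∧
      ‖a - b‖ ≤ Real.sqrt (Fintype.card d) * dist x y := by
  obtain ⟨a, b, ha, hb, h⟩ := exists_lift_forall_abs_sub_le_dist x y
  refine ⟨a, b, ha, hb, ?_⟩
  rw [EuclideanSpace.norm_eq]
  have hsum : ∑ i, ‖(a - b) i‖ ^ 2 ≤ ∑ _i : d, dist x y ^ 2 := by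
    refine Finset.sum_le_sum fun i _ => ?_
    rw [Real.norm_eq_abs, PiLp.sub_apply]
    exact pow_le_pow_left₀ (abs_nonneg _) (h i) 2
  calc Real.sqrt (∑ i, ‖(a - b) i‖ ^ 2) ≤ Real.sqrt (∑ _i : d, dist x y ^ 2) :=
        Real.sqrt_le_sqrt hsum
    _ = Real.sqrt (Fintype.card d) * dist x y := by
        rw [Finset.sum_const, Finset.card_univ, nsmul_eq_mul, Real.sqrt_mul (Nat.cast_nonneg _),
          Real.sqrt_sq dist_nonneg]

end Torus


/-! ## Generic comparison lemmas for `eSupNorm` / `eHolderNorm` -/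

section Generic

variable {X X' Y Y' : Type*} [PseudoEMetricSpace X] [PseudoEMetricSpace X']
  [NormedAddCommGroup Y] [NormedAddCommGroup Y']

/-- Monotonicity of the Hölder seminorm under a pointwise comparison of increments. [folklore] -/
theorem eHolderNorm_le_of_edist_le {r : ℝ≥0} {f : X → Y} {g : X → Y'}
    (h : ∀ x y, edist (g x) (g y) ≤ edist (f x) (f y)) : eHolderNorm r g ≤ eHolderNorm r f := by
  unfold eHolderNorm
  refine le_iInf₂ fun C hC => iInf₂_le C ?_
  exact fun x y => (h x y).trans (hC x y)

/-- Monotonicity of the sup norm under a pointwise comparison of norms. [folklore] -/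
theorem eSupNorm_le_of_norm_le {Z : Type*} {f : Z → Y} {g : Z → Y'} (h : ∀ x, ‖g x‖ ≤ ‖f x‖) :
    eSupNorm g ≤ eSupNorm f := by
  refine iSup_le fun x => le_trans ?_ (enorm_le_eSupNorm f x)
  rw [← ofReal_norm, ← ofReal_norm]
  exact ENNReal.ofReal_le_ofReal (h x)

/-- Pre-composition with a `1`-Lipschitz map does not increase the Hölder seminorm
(`HolderWith.comp` with a `1`-Lipschitz map). [folklore] -/
theorem eHolderNorm_comp_le_of_lipschitz {r : ℝ≥0} {f : X → Y} {φ : X' → X}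
    (hφ : LipschitzWith 1 φ) : eHolderNorm r (f ∘ φ) ≤ eHolderNorm r f := by
  unfold eHolderNorm
  refine le_iInf₂ fun C hC => iInf₂_le C ?_
  intro x y
  calc edist (f (φ x)) (f (φ y)) ≤ C * edist (φ x) (φ y) ^ (r : ℝ) := hC _ _
    _ ≤ C * edist x y ^ (r : ℝ) := by
        gcongr
        simpa using hφ x y

/-- Pre-composition does not increase the sup norm. [folklore] -/
theorem eSupNorm_comp_le {Z Z' : Type*} (f : Z → Y) (φ : Z' → Z) :
    eSupNorm (f ∘ φ) ≤ eSupNorm f :=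
  iSup_le fun x => enorm_le_eSupNorm f (φ x)

/-- Pre-composition with a `1`-Lipschitz map does not increase the `C^{0,r}` norm. [folklore] -/
theorem eBoundedHolderNorm_comp_le_of_lipschitz {r : ℝ≥0} {f : X → Y} {φ : X' → X}
    (hφ : LipschitzWith 1 φ) : eBoundedHolderNorm r (f ∘ φ) ≤ eBoundedHolderNorm r f :=
  add_le_add (eSupNorm_comp_le f φ) (eHolderNorm_comp_le_of_lipschitz hφ)

/-- Post-composition with a map that does not increase distances and norms (e.g. a linear
isometry, a coordinate projection) does not increase the `C^{0,r}` norm. [folklore] -/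
theorem eBoundedHolderNorm_postcomp_le {r : ℝ≥0} {f : X → Y} {L : Y → Y'}
    (hL : ∀ a b, ‖L a - L b‖ ≤ ‖a - b‖) (hL0 : ∀ a, ‖L a‖ ≤ ‖a‖) :
    eBoundedHolderNorm r (L ∘ f) ≤ eBoundedHolderNorm r f := by
  refine add_le_add (eSupNorm_le_of_norm_le fun x => hL0 (f x))
    (eHolderNorm_le_of_edist_le fun x y => ?_)
  rw [edist_eq_enorm_sub, edist_eq_enorm_sub, ← ofReal_norm, ← ofReal_norm]
  exact ENNReal.ofReal_le_ofReal (hL _ _)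

end Generic

section GenericMetric

variable {X Y : Type*} [MetricSpace X] [NormedAddCommGroup Y] [NormedSpace ℝ Y]

/-- Homogeneity of the `C^{0,r}` norm under real scalars (`eHolderNorm_smul`). [folklore] -/
theorem eBoundedHolderNorm_const_smul (r : ℝ≥0) (c : ℝ) (f : X → Y) :
    eBoundedHolderNorm r (c • f) = ‖c‖ₑ * eBoundedHolderNorm r f := by
  rw [eBoundedHolderNorm, eBoundedHolderNorm, eHolderNorm_smul, mul_add]
  congr 1
  simp only [eSupNorm, Pi.smul_apply, enorm_smul, ENNReal.mul_iSup]

omit [NormedSpace ℝ Y] in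
/-- The sup norm is submultiplicative on products `a • b`. [folklore] -/
theorem eSupNorm_smul_le [NormedSpace ℝ Y] {Z : Type*} (a : Z → ℝ) (b : Z → Y) :
    eSupNorm (fun x => a x • b x) ≤ eSupNorm a * eSupNorm b := by
  refine iSup_le fun x => ?_
  rw [enorm_smul]
  exact mul_le_mul' (enorm_le_eSupNorm a x) (enorm_le_eSupNorm b x)

/-- **Product rule in `C^{0,r}`** (Gilbarg–Trudinger (4.7)): for a bounded `r`-Hölder scalar `a`
and a bounded `r`-Hölder vector `b`,
`[a • b]_r ≤ ‖a‖_∞ [b]_r + [a]_r ‖b‖_∞`. Stated at the level of `HolderWith` constants. [cite: GilbargTrudinger2001, §4.1 (4.7)] -/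
theorem holderWith_smul_of_nnnorm_le {r Ca Cb Ma Mb : ℝ≥0} {a : X → ℝ}
    {b : X → Y} (ha : HolderWith Ca r a) (hb : HolderWith Cb r b) (hMa : ∀ x, ‖a x‖₊ ≤ Ma)
    (hMb : ∀ x, ‖b x‖₊ ≤ Mb) : HolderWith (Ma * Cb + Ca * Mb) r (fun x => a x • b x) := by
  intro x y
  have h1 : edist (a x • b x) (a y • b y) ≤
      ‖a x‖ₑ * edist (b x) (b y) + edist (a x) (a y) * ‖b y‖ₑ := by
    calc edist (a x • b x) (a y • b y)
        ≤ edist (a x • b x) (a x • b y) + edist (a x • b y) (a y • b y) := edist_triangle _ _ _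
      _ = ‖a x‖ₑ * edist (b x) (b y) + edist (a x) (a y) * ‖b y‖ₑ := by
          rw [edist_eq_enorm_sub, edist_eq_enorm_sub, edist_eq_enorm_sub (a x),
            edist_eq_enorm_sub (b x), ← smul_sub, enorm_smul, ← sub_smul, enorm_smul]
  refine h1.trans ?_
  calc ‖a x‖ₑ * edist (b x) (b y) + edist (a x) (a y) * ‖b y‖ₑ
      ≤ Ma * (Cb * edist x y ^ (r : ℝ)) + (Ca * edist x y ^ (r : ℝ)) * Mb := by
        gcongr
        · exact_mod_cast hMa x
        · exact hb x y
        · exact ha x y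
        · exact_mod_cast hMb y
    _ = ((Ma * Cb + Ca * Mb : ℝ≥0) : ℝ≥0∞) * edist x y ^ (r : ℝ) := by
        push_cast
        ring

/-- **Product rule in `C^{0,r}`** for finite norms:
`[a • b]_r ≤ ‖a‖_∞ [b]_r + [a]_r ‖b‖_∞` (Gilbarg–Trudinger (4.7)). [cite: GilbargTrudinger2001, §4.1 (4.7)] -/
theorem eHolderNorm_smul_le {r : ℝ≥0} {a : X → ℝ} {b : X → Y}
    (ha : MemHolder r a) (hb : MemHolder r b) (hMa : eSupNorm a < ∞) (hMb : eSupNorm b < ∞) :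
    eHolderNorm r (fun x => a x • b x) ≤
      eSupNorm a * eHolderNorm r b + eHolderNorm r a * eSupNorm b := by
  have hMa' : ∀ x, ‖a x‖₊ ≤ (eSupNorm a).toNNReal := fun x => by
    rw [← ENNReal.coe_le_coe, ENNReal.coe_toNNReal hMa.ne, ← enorm_eq_nnnorm]
    exact enorm_le_eSupNorm a x
  have hMb' : ∀ x, ‖b x‖₊ ≤ (eSupNorm b).toNNReal := fun x => by
    rw [← ENNReal.coe_le_coe, ENNReal.coe_toNNReal hMb.ne, ← enorm_eq_nnnorm]
    exact enorm_le_eSupNorm b x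
  have h := (holderWith_smul_of_nnnorm_le ha.holderWith hb.holderWith hMa' hMb').eHolderNorm_le
  refine h.trans (le_of_eq ?_)
  rw [ENNReal.coe_add, ENNReal.coe_mul, ENNReal.coe_mul, ENNReal.coe_toNNReal hMa.ne,
    ENNReal.coe_toNNReal hMb.ne, ha.coe_nnHolderNorm_eq_eHolderNorm,
    hb.coe_nnHolderNorm_eq_eHolderNorm]

/-- **Product rule in `C^{0,r}`**, norm form: for finite norms,
`‖a • b‖_{C^{0,r}} ≤ ‖a‖_∞ ‖b‖_{C^{0,r}} + [a]_r ‖b‖_∞` (Gilbarg–Trudinger (4.7)). [cite: GilbargTrudinger2001, §4.1 (4.7)] -/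
theorem eBoundedHolderNorm_smul_le {r : ℝ≥0} {a : X → ℝ} {b : X → Y}
    (ha : MemBoundedHolder r a) (hb : MemBoundedHolder r b) :
    eBoundedHolderNorm r (fun x => a x • b x) ≤
      eSupNorm a * eBoundedHolderNorm r b + eHolderNorm r a * eSupNorm b := by
  rw [eBoundedHolderNorm, eBoundedHolderNorm, mul_add, add_assoc]
  exact add_le_add (eSupNorm_smul_le a b)
    (eHolderNorm_smul_le ha.memHolder hb.memHolder ha.eSupNorm_lt_top hb.eSupNorm_lt_top)

end GenericMetric


/-! ## The bridge between the intrinsic and the lifted Hölder norms on `T^d` -/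

namespace Torus

variable {d : Type*} [Fintype d] {Y : Type*} [NormedAddCommGroup Y]

/-- The constant of the Hölder bridge: `(√(card d))^r` (the Euclidean diameter of a good lift
of a sup-metric ball, raised to the Hölder exponent). [folklore] -/
def holderLiftConst (d : Type*) [Fintype d] (r : ℝ≥0) : ℝ≥0 :=
  NNReal.sqrt (Fintype.card d) ^ (r : ℝ)


/-- **Hölder bridge, seminorm level.** If the periodic lift of `g` is `r`-Hölder with constant
`C` for the Euclidean metric, then `g` is `r`-Hölder with constant `C (√d)^r` for the intrinsic
(sup) metric of `T^d` (good lifts: `‖a - b‖ ≤ √d · dist x y`). [folklore] -/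
theorem HolderWith.of_lift {C r : ℝ≥0} {g : UnitAddTorus d → Y} (h : HolderWith C r (lift g)) :
    HolderWith (C * holderLiftConst d r) r g := by
  intro x y
  obtain ⟨a, b, rfl, rfl, hab⟩ := exists_lift_norm_sub_le x y
  have h1 := h a b
  rw [lift_apply, lift_apply] at h1
  refine h1.trans ?_
  rw [edist_eq_enorm_sub, ← ofReal_norm, ENNReal.coe_mul, mul_assoc]
  gcongr
  calc ENNReal.ofReal ‖a - b‖ ^ (r : ℝ)
      ≤ (ENNReal.ofReal (Real.sqrt (Fintype.card d) * dist (proj a) (proj b))) ^ (r : ℝ) := by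
        gcongr
    _ = (holderLiftConst d r : ℝ≥0∞) * edist (proj a) (proj b) ^ (r : ℝ) := by
        rw [ENNReal.ofReal_mul (Real.sqrt_nonneg _),
          ENNReal.mul_rpow_of_nonneg _ _ (NNReal.coe_nonneg r),
          edist_dist, holderLiftConst, ENNReal.coe_rpow_of_nonneg _ (NNReal.coe_nonneg r)]
        congr 2
        have : Real.sqrt (Fintype.card d : ℝ) = ((NNReal.sqrt (Fintype.card d) : ℝ≥0) : ℝ) := by
          rw [Real.coe_sqrt, NNReal.coe_natCast]
        rw [this, ENNReal.ofReal_coe_nnreal]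

/-- **Hölder bridge, seminorm level**: `[g]_{r, T^d} ≤ (√d)^r [lift g]_{r, ℝ^d}` (in `ℝ≥0∞`,
with the convention `c · ∞ = ∞`; for empty `d` both sides vanish). [folklore] -/
theorem eHolderNorm_le_holderLiftConst_mul (r : ℝ≥0) (g : UnitAddTorus d → Y) :
    eHolderNorm r g ≤ holderLiftConst d r * eHolderNorm r (lift g) := by
  by_cases hg : MemHolder r (lift g)
  · calc eHolderNorm r g ≤ (nnHolderNorm r (lift g) * holderLiftConst d r : ℝ≥0) :=
          (HolderWith.of_lift hg.holderWith).eHolderNorm_le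
      _ = holderLiftConst d r * eHolderNorm r (lift g) := by
          rw [ENNReal.coe_mul, hg.coe_nnHolderNorm_eq_eHolderNorm, mul_comm]
  · rw [← eHolderNorm_ne_top, not_ne_iff] at hg
    rw [hg]
    rcases isEmpty_or_nonempty d with hd | hd
    · -- the torus is a point
      have : eHolderNorm r g = 0 := by
        rw [eHolderNorm_eq_zero]
        intro x₁ x₂
        rw [Subsingleton.elim x₁ x₂]
      rw [this]
      exact bot_le
    · have hc : (holderLiftConst d r : ℝ≥0∞) ≠ 0 := by
        have : (0 : ℝ≥0) < NNReal.sqrt (Fintype.card d) := by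
          rw [NNReal.sqrt_pos]; exact_mod_cast Fintype.card_pos
        simp [holderLiftConst, (NNReal.rpow_pos this).ne']
      rw [ENNReal.mul_top hc]
      exact le_top

end Torus

section IteratedZero
variable {E' Y : Type*} [NormedAddCommGroup E'] [NormedSpace ℝ E'] [NormedAddCommGroup Y]
  [NormedSpace ℝ Y]

/-- The `0`-th derivative `D⁰ f` has the same Hölder seminorm as `f`. [folklore] -/
theorem eHolderNorm_iteratedFDeriv_zero (r : ℝ≥0) (f : E' → Y) :
    eHolderNorm r (iteratedFDeriv ℝ 0 f) = eHolderNorm r f := by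
  unfold eHolderNorm
  simp only [holderWith_iteratedFDeriv_zero_iff]

/-- `‖f‖_{C^{0,r}}` in terms of the `C^{k,r}` scale: `eContDiffHolderNorm 0 r f = ‖f‖_∞ + [f]_r`. [folklore] -/
theorem eContDiffHolderNorm_zero_eq (r : ℝ≥0) (f : E' → Y) :
    eContDiffHolderNorm 0 r f = eSupNorm f + eHolderNorm r f := by
  rw [eContDiffHolderNorm, Finset.sum_range_one, eSupNorm_iteratedFDeriv_zero,
    eHolderNorm_iteratedFDeriv_zero]

/-- `eContDiffHolderNorm 1 r f = ‖f‖_∞ + ‖Df‖_∞ + [Df]_r` (Gilbarg–Trudinger (4.4), `k = 1`). [folklore] -/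
theorem eContDiffHolderNorm_one_eq (r : ℝ≥0) (f : E' → Y) :
    eContDiffHolderNorm 1 r f =
      eSupNorm f + eSupNorm (iteratedFDeriv ℝ 1 f) + eHolderNorm r (iteratedFDeriv ℝ 1 f) := by
  rw [eContDiffHolderNorm, Finset.sum_range_succ, Finset.sum_range_one,
    eSupNorm_iteratedFDeriv_zero]

/-- Evaluating the first derivative at a fixed unit vector is dominated, in norm, by the first
derivative: `‖Df(a) e‖ ≤ ‖D¹f(a)‖` for `‖e‖ ≤ 1` (`iteratedFDeriv_one_apply`). [folklore] -/
theorem norm_fderiv_apply_le_norm_iteratedFDeriv_one (f : E' → Y) (a : E') {e : E'}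
    (he : ‖e‖ ≤ 1) : ‖fderiv ℝ f a e‖ ≤ ‖iteratedFDeriv ℝ 1 f a‖ := by
  have h := (iteratedFDeriv ℝ 1 f a).le_opNorm (fun _ => e)
  rw [iteratedFDeriv_one_apply, Fin.prod_univ_one] at h
  exact h.trans (mul_le_of_le_one_right (norm_nonneg _) he)

/-- Increments of `a ↦ Df(a) e` are dominated by increments of `D¹f` for `‖e‖ ≤ 1`. [folklore] -/
theorem norm_fderiv_apply_sub_le (f : E' → Y) (a b : E') {e : E'} (he : ‖e‖ ≤ 1) :
    ‖fderiv ℝ f a e - fderiv ℝ f b e‖ ≤ ‖iteratedFDeriv ℝ 1 f a - iteratedFDeriv ℝ 1 f b‖ := by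
  have h := (iteratedFDeriv ℝ 1 f a - iteratedFDeriv ℝ 1 f b).le_opNorm (fun _ => e)
  rw [sub_apply, iteratedFDeriv_one_apply, iteratedFDeriv_one_apply,
    Fin.prod_univ_one] at h
  rw [← _root_.sub_apply] at h ⊢
  simpa using h.trans (mul_le_of_le_one_right (norm_nonneg _) he)

end IteratedZero

namespace Torus

variable {d : Type*} [Fintype d] {Y : Type*} [NormedAddCommGroup Y] [NormedSpace ℝ Y]

omit [Fintype d] [NormedSpace ℝ Y] in
/-- The sup norm of the periodic lift is the sup norm on the torus (`proj` is onto). [folklore] -/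
theorem eSupNorm_lift (g : UnitAddTorus d → Y) : eSupNorm (lift g) = eSupNorm g := by
  unfold eSupNorm
  rw [show (fun y => ‖lift g y‖ₑ) = (fun x => ‖g x‖ₑ) ∘ proj from rfl]
  exact proj_surjective.iSup_comp (fun x => ‖g x‖ₑ)

/-- **Hölder bridge, `C^{0,r}`**: the intrinsic inhomogeneous Hölder norm on `T^d` is controlled
by the lifted `C^{0,r}` norm: `‖g‖_∞ + [g]_r ≤ (1 + (√d)^r) ‖g‖_{C^{0,r}}` where the right-hand
side is `Torus.eContDiffHolderNorm 0 r g` (the accepted `C^{k,r}(T^d)` scale).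
[cite: GilbargTrudinger2001, §4.1 (4.4)–(4.6)] -/
theorem eBoundedHolderNorm_le_eContDiffHolderNorm_zero (r : ℝ≥0) (g : UnitAddTorus d → Y) :
    eBoundedHolderNorm r g ≤ (1 + holderLiftConst d r) * Torus.eContDiffHolderNorm 0 r g := by
  rw [Torus.eContDiffHolderNorm, eContDiffHolderNorm_zero_eq, eSupNorm_lift, eBoundedHolderNorm,
    add_mul, one_mul]
  calc eSupNorm g + eHolderNorm r g
      ≤ eSupNorm g + holderLiftConst d r * eHolderNorm r (lift g) :=
        add_le_add le_rfl (eHolderNorm_le_holderLiftConst_mul r g)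
    _ ≤ (eSupNorm g + eHolderNorm r (lift g)) +
          holderLiftConst d r * (eSupNorm g + eHolderNorm r (lift g)) := by
        rw [mul_add]
        exact add_le_add (le_self_add) (le_add_self)

variable [DecidableEq d]

/-- The periodic lift of a partial derivative of a `C¹` function is a directional value of the
derivative of the lift: `lift (∂ᵢ g) a = D(lift g)(a) eᵢ` (`Torus.fderiv_lift`). [folklore] -/
theorem lift_partialDeriv_eq {g : UnitAddTorus d → Y} (hg : IsContDiff 1 g) (i : d) :
    lift (partialDeriv i g) = fun a => _root_.fderiv ℝ (lift g) a (EuclideanSpace.single i 1) := by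
  funext a
  rw [lift_apply, partialDeriv_eq_fderiv_apply hg, fderiv_lift]

/-- **Hölder bridge, first derivatives**: for `C¹` functions on `T^d`,
`‖∂ᵢ g‖_∞ + [∂ᵢ g]_r ≤ (1 + (√d)^r) ‖g‖_{C^{1,r}}` (`Torus.eContDiffHolderNorm 1 r g`).
[cite: GilbargTrudinger2001, §4.1 (4.4)–(4.6)] -/
theorem eBoundedHolderNorm_partialDeriv_le {g : UnitAddTorus d → Y} (hg : IsContDiff 1 g) (i : d)
    (r : ℝ≥0) :
    eBoundedHolderNorm r (partialDeriv i g) ≤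
      (1 + holderLiftConst d r) * Torus.eContDiffHolderNorm 1 r g := by
  have he : ‖(EuclideanSpace.single i (1 : ℝ) : EuclideanSpace ℝ d)‖ ≤ 1 := by
    simp
  -- sup part
  have hsup : eSupNorm (partialDeriv i g) ≤ eSupNorm (iteratedFDeriv ℝ 1 (lift g)) := by
    rw [← eSupNorm_lift, lift_partialDeriv_eq hg]
    exact eSupNorm_le_of_norm_le fun a => norm_fderiv_apply_le_norm_iteratedFDeriv_one _ a he
  -- Hölder part
  have hhol : eHolderNorm r (partialDeriv i g) ≤
      holderLiftConst d r * eHolderNorm r (iteratedFDeriv ℝ 1 (lift g)) := by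
    refine (eHolderNorm_le_holderLiftConst_mul r _).trans ?_
    gcongr
    rw [lift_partialDeriv_eq hg]
    refine eHolderNorm_le_of_edist_le fun a b => ?_
    rw [edist_eq_enorm_sub, edist_eq_enorm_sub, ← ofReal_norm, ← ofReal_norm]
    exact ENNReal.ofReal_le_ofReal (norm_fderiv_apply_sub_le _ a b he)
  rw [Torus.eContDiffHolderNorm, eContDiffHolderNorm_one_eq, eBoundedHolderNorm, add_mul, one_mul,
    mul_add]
  calc eSupNorm (partialDeriv i g) + eHolderNorm r (partialDeriv i g)
      ≤ eSupNorm (iteratedFDeriv ℝ 1 (lift g)) +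
          holderLiftConst d r * eHolderNorm r (iteratedFDeriv ℝ 1 (lift g)) := add_le_add hsup hhol
    _ ≤ (eSupNorm (lift g) + eSupNorm (iteratedFDeriv ℝ 1 (lift g)) +
          eHolderNorm r (iteratedFDeriv ℝ 1 (lift g))) +
        (holderLiftConst d r * (eSupNorm (lift g) + eSupNorm (iteratedFDeriv ℝ 1 (lift g))) +
          holderLiftConst d r * eHolderNorm r (iteratedFDeriv ℝ 1 (lift g))) := by
        refine add_le_add ?_ le_add_self
        exact le_add_right le_add_self

/-- The sup norm of a partial derivative of a `C¹` function is controlled by `‖g‖_{C^{1,r}}`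
(any `r`). [folklore] -/
theorem eSupNorm_partialDeriv_le {g : UnitAddTorus d → Y} (hg : IsContDiff 1 g) (i : d)
    (r : ℝ≥0) : eSupNorm (partialDeriv i g) ≤ Torus.eContDiffHolderNorm 1 r g := by
  have he : ‖(EuclideanSpace.single i (1 : ℝ) : EuclideanSpace ℝ d)‖ ≤ 1 := by
    simp
  rw [Torus.eContDiffHolderNorm, eContDiffHolderNorm_one_eq, ← eSupNorm_lift,
    lift_partialDeriv_eq hg]
  refine le_add_right (le_add_left ?_)
  exact eSupNorm_le_of_norm_le fun a => norm_fderiv_apply_le_norm_iteratedFDeriv_one _ a he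

omit [DecidableEq d] in
/-- The sup norm on the torus is controlled by `‖g‖_{C^{0,r}}` (any `r`). [folklore] -/
theorem eSupNorm_le_eContDiffHolderNorm_zero (g : UnitAddTorus d → Y) (r : ℝ≥0) :
    eSupNorm g ≤ Torus.eContDiffHolderNorm 0 r g := by
  rw [Torus.eContDiffHolderNorm, eContDiffHolderNorm_zero_eq, eSupNorm_lift]
  exact le_self_add

end Torus

/-! ## `C^{0,r}` bounds from `C¹` bounds; uniform bounds for jointly smooth fields -/

namespace Torus

variable {d : Type*} [Fintype d] [DecidableEq d] {Y : Type*} [NormedAddCommGroup Y]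
  [NormedSpace ℝ Y]

/-- A bound on all partial derivatives of a `C¹` function on `T^d` bounds the derivative of its
periodic lift: `‖D(lift g)(a)‖ ≤ ∑ᵢ Mᵢ` (`Df w = ∑ wᵢ ∂ᵢ f`, `|wᵢ| ≤ ‖w‖`). [folklore] -/
theorem norm_fderiv_lift_le_of_norm_partialDeriv_le {g : UnitAddTorus d → Y} (hg : IsContDiff 1 g)
    {M : d → ℝ} (h : ∀ i x, ‖partialDeriv i g x‖ ≤ M i) (a : EuclideanSpace ℝ d) :
    ‖_root_.fderiv ℝ (lift g) a‖ ≤ ∑ i, M i := by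
  have hM : 0 ≤ ∑ i, M i := Finset.sum_nonneg fun i _ => (norm_nonneg _).trans (h i (proj a))
  refine ContinuousLinearMap.opNorm_le_bound _ hM fun w => ?_
  rw [fderiv_lift, fderiv_apply_eq_sum_partialDeriv hg, Finset.sum_mul]
  refine (norm_sum_le _ _).trans (Finset.sum_le_sum fun i _ => ?_)
  rw [norm_smul, mul_comm]
  exact mul_le_mul (h i _) (by simpa using PiLp.norm_apply_le w i) (norm_nonneg _)
    ((norm_nonneg _).trans (h i (proj a)))

/-- **Lipschitz bound from partial derivatives on `T^d`.** A `C¹` function with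
`‖∂ᵢ g‖_∞ ≤ Mᵢ` is Lipschitz for the intrinsic metric with constant `√d ∑ᵢ Mᵢ` (mean value
inequality on `ℝ^d` along good lifts). [folklore] -/
theorem lipschitzWith_of_norm_partialDeriv_le {g : UnitAddTorus d → Y} (hg : IsContDiff 1 g)
    {M : d → ℝ≥0} (h : ∀ i x, ‖partialDeriv i g x‖ ≤ M i) :
    LipschitzWith (NNReal.sqrt (Fintype.card d) * ∑ i, M i) g := by
  refine LipschitzWith.of_dist_le_mul fun x y => ?_
  obtain ⟨a, b, rfl, rfl, hab⟩ := exists_lift_norm_sub_le x y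
  have hmv : ‖lift g a - lift g b‖ ≤ (∑ i, (M i : ℝ)) * ‖a - b‖ :=
    (convex_univ).norm_image_sub_le_of_norm_fderiv_le
      (fun z _ => ((hg.differentiable one_ne_zero) z))
      (fun z _ => norm_fderiv_lift_le_of_norm_partialDeriv_le hg (M := fun i => (M i : ℝ)) h z)
      (mem_univ b) (mem_univ a)
  rw [lift_apply, lift_apply] at hmv
  rw [dist_eq_norm]
  refine hmv.trans ?_
  have hM : 0 ≤ ∑ i, (M i : ℝ) := Finset.sum_nonneg fun i _ => (M i).2
  calc (∑ i, (M i : ℝ)) * ‖a - b‖ ≤ (∑ i, (M i : ℝ)) * (Real.sqrt (Fintype.card d) *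
        dist (proj a) (proj b)) := mul_le_mul_of_nonneg_left hab hM
    _ = ↑(NNReal.sqrt (Fintype.card d) * ∑ i, M i) * dist (proj a) (proj b) := by
        push_cast
        ring

/-- **`C^{0,r}` bound from `C¹` bounds on `T^d`.** For `r ≤ 1`, a `C¹` function with
`‖g‖_∞ ≤ M₀` and `‖∂ᵢ g‖_∞ ≤ Mᵢ` has `‖g‖_∞ + [g]_r ≤ M₀ + (√d ∑ᵢ Mᵢ + 2 M₀)`
(Gilbarg–Trudinger §4.1: `C¹ ⊆ C^{0,α}` on bounded domains). [cite: GilbargTrudinger2001, §4.1] -/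
theorem eBoundedHolderNorm_le_of_norm_le_of_norm_partialDeriv_le {g : UnitAddTorus d → Y}
    (hg : IsContDiff 1 g) {r M₀ : ℝ≥0} {M : d → ℝ≥0} (hr : r ≤ 1) (h0 : ∀ x, ‖g x‖ ≤ M₀)
    (h : ∀ i x, ‖partialDeriv i g x‖ ≤ M i) :
    eBoundedHolderNorm r g ≤
      (M₀ + (NNReal.sqrt (Fintype.card d) * (∑ i, M i) + 2 * M₀) : ℝ≥0) := by
  have hM0 : ∀ x, ‖g x‖ₑ ≤ M₀ := fun x => by
    rw [← ofReal_norm, ← ENNReal.ofReal_coe_nnreal]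
    exact ENNReal.ofReal_le_ofReal (h0 x)
  have hH := ((lipschitzWith_of_norm_partialDeriv_le hg h).holderWith_of_enorm_le hM0 hr)
  rw [ENNReal.coe_add]
  exact add_le_add (iSup_le hM0) hH.eHolderNorm_le

/-- **Uniform `C^{0,r}` bounds for jointly smooth fields on compact time sets.** If
`u : ℝ → T^d → Y` is jointly smooth on `S × T^d` with `S` compact (and of unique
differentiability, e.g. a nontrivial compact interval), then for `r ≤ 1` the norms
`‖u t‖_∞ + [u t]_r` are bounded uniformly in `t ∈ S` (the field and its spatial partial
derivatives are continuous, hence bounded, on the compact `S × T^d`). [folklore] -/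
theorem IsSmoothSpaceTimeOn.exists_forall_eBoundedHolderNorm_le {S : Set ℝ}
    {u : ℝ → UnitAddTorus d → Y} (hu : IsSmoothSpaceTimeOn S u) (hS : IsCompact S)
    (hS' : UniqueDiffOn ℝ S) {r : ℝ≥0} (hr : r ≤ 1) :
    ∃ B : ℝ≥0, ∀ t ∈ S, eBoundedHolderNorm r (u t) ≤ B := by
  obtain ⟨C₀, hC₀⟩ := hu.exists_norm_le_of_isCompact hS subset_rfl
  choose C hC using fun i => (hu.partialDeriv hS' i).exists_norm_le_of_isCompact hS subset_rfl
  refine ⟨C₀.toNNReal + (NNReal.sqrt (Fintype.card d) * (∑ i, (C i).toNNReal) + 2 * C₀.toNNReal),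
    fun t ht => ?_⟩
  refine eBoundedHolderNorm_le_of_norm_le_of_norm_partialDeriv_le
    ((hu.isSmooth_slice ht).isContDiff (by simp)) hr (fun x => ?_) (fun i x => ?_)
  · exact (hC₀ t ht x).trans (Real.le_coe_toNNReal C₀)
  · exact (hC i t ht x).trans (Real.le_coe_toNNReal (C i))

end Torus

end Literature.Analysis.FunctionSpaces

end
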